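import Mathlib
import Literature.NumberTheory.EllipticCurves.HeegnerPoints
import Literature.NumberTheory.EllipticCurves.QuadraticTwist
import Literature.NumberTheory.EllipticCurves.QuadraticTwistSelmerPInfty
import Literature.NumberTheory.EllipticCurves.BSDSelmerCMPConverseGoldfeldProofs
import Literature.NumberTheory.EllipticCurves.TwoIsogenySelmerGroup
import Literature.NumberTheory.EllipticCurves.TwoIsogenySelmerGroupSha
import Literature.NumberTheory.EllipticCurves.TwoIsogenyTorsor
import Literature.NumberTheory.EllipticCurves.MordellWeil
import Literature.NumberTheory.EllipticCurves.Selmer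
import Literature.NumberTheory.EllipticCurves.BSDSha
import Literature.NumberTheory.QuadraticForms.HilbertSymbol

/-!
# Transfer lens g27 (seat bsd-idea-18) — the HOISTED pairing formula (critic V#24c faithfulness nit)

Crux `HeegnerTwistCouplingInSupply` (stmt-BirchSwinnertonDyer-21381), `j = 0` / X12₋ corner, EC half
`J0S8Sym`.  Critic V#24c (2026-08-28T22:13:07Z) ACCEPTED g26's general transcription
`CasselsTateTwoIsogenyTangentFormula` (`SketchTransferG26.lean`, 649b6cf82af7 / tree 1e22ddd3a72a) as a
true, typable literature input, with ONE non-blocking faithfulness nit: there `∃ B` sits AFTER `∀ a b d e`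
(and after the `(a,b)`-model hypothesis), so the pairing is allowed to depend on `d`; in print it is ONE
pairing — the Cassels–Tate pairing of `V` — for all `d, e, c, η`.  The INPUTS desk booked the statement as
row **B-29** (information row, "typed copy-ready by idea-18 in SketchTransferG26.lean").  This file makes
the copy-ready text faithful:

* `CasselsTateTwoIsogenyPairingFormula` — the HOIST the critic prescribes:
  `∀ V [two-torsion NF] [elliptic], ∃ B (alternating, bi-additive on Ш(V)), ∀ a b d e c η …` with the
  clauses (i) (i′) (ii) (iii) of g26 VERBATIM.  One `B` for every factorisation `d·e = b`, every dual-conic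
  point `c` and every `η`.
* `CasselsTateTwoIsogenyPairingFormulaCT` — the same with `B` additionally carrying the tree's
  characterisation of a Cassels–Tate pairing (`WeierstrassCurve.exists_casselsTate_pairing`, `BSDSha.lean`:
  alternating AND kernel = `AddSubgroup.divisibleElements Ш(V)`, AEC X.4.14).  The tree exposes no NAMED
  pairing object (its fact is `∃`-shaped), so "name `B` := the CT pairing" is not expressible; conjoining the
  tree's two characterising clauses under the same `∃` is the closest faithful substitute ("`B` is a
  Cassels–Tate pairing in the tree's sense and satisfies Cassels' 2-isogeny formula").  Sources for the extra
  clause: Cassels 1962 (Crelle 211) / AEC X.4.14, exactly as cited on `exists_casselsTate_pairing`.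
* KERNEL-CHECKED glue (no `sorry`):
  `pairingFormula_of_CT : …CT → CasselsTateTwoIsogenyPairingFormula` (drop the kernel clause),
  `tangentFormula_of_pairingFormula : CasselsTateTwoIsogenyPairingFormula → CasselsTateTwoIsogenyTangentFormula`
  (hoisted ⇒ g26's un-hoisted form: instantiate the one `B`),
  `casselsFormulaX12_of_pairingFormula : CasselsTateTwoIsogenyPairingFormula → CasselsFormulaX12` and
  `casselsFormulaX12_of_CT` (so the g25 chain `j0s8Sym_of_parts` composes with either hoisted form exactly as
  the critic's `criticBridge24c` did with g26's), and
  `casselsTate_clause_of_CT : …CT → ∀ V [NF] [elliptic], ∃ B, alternating ∧ kernel = divisible` — the body of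
  `exists_casselsTate_pairing (K := ℚ)` restricted to two-torsion-normal-form curves (currency check: the CT
  variant is a strengthening of the tree's fact on those curves, not a second, unrelated pairing).

For the X12 consumer the hoist is immaterial (one `d = −p`; `SharpSecondDescentCorankZero` / `BridgeX12` of
g25 need only SOME alternating bi-additive `B` with one value `≠ 0`), which is why g26's weaker-than-print
form was still TRUE and sufficient; the hoisted forms are for the typer (B-29) and for any second consumer
that must identify the pairing across two uses.

Everything from `set_option` to `end X12` below is the g26 file VERBATIM (namespace `TransferG26` ↦
`TransferG27` only), so `CasselsFormulaX12`, `CasselsTateTwoIsogenyTangentFormula` and the ten g25 objects are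
byte-identical to their g25/g26 copies (an `Iff.rfl` probe across concatenated files elaborates, as in V#24c).

Nothing here is an item, a stub or a registered skeleton (W-71/W-79: publish-only; the records of 21381 /
19225 are untouched; `ledger skeleton check` is NOT run).  The two hoisted `Prop`s are literature INPUTS
(unproved here); `CasselsFormulaX12` is NOT proved here.  **BSD is not proved by any of this.**
-/

set_option linter.dupNamespace false

noncomputable section

namespace Summit.BirchSwinnertonDyer.BirchSwinnertonDyer.Cruxes.HeegnerTwistCouplingInSupply.TransferG27

open Literature.NumberTheory.EllipticCurves WeierstrassCurve
open Literature.NumberTheory.QuadraticForms (hilbertSymbol)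
open WeierstrassCurve.Affine (SqUnits sqClass)
open Padic

/-! ### Verbatim copies of the g24/g25 objects (`SketchTransferG25.lean`, 0d7cd825b1f9) -/

/-- The X12 corner parameters: primes `p ≡ 11 (mod 12)`, `ℓ ≡ 23 (mod 24)` with `(ℓ/p) = −1`. -/
def IsX12Pair (p ℓ : ℕ) : Prop :=
  p.Prime ∧ ℓ.Prime ∧ p % 12 = 11 ∧ ℓ % 24 = 23 ∧ jacobiSym (ℓ : ℤ) p = -1

/-- The two-torsion normal form `E_X12 = ⟨0, −3pℓ, 0, 3p²ℓ², 0⟩` of `y² = x³ + (pℓ)³`. -/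
def EX12 (p ℓ : ℕ) : WeierstrassCurve ℚ := ⟨0, -3 * ((p : ℚ) * ℓ), 0, 3 * ((p : ℚ) * ℓ) ^ 2, 0⟩

instance isTwoTorsionNF_EX12 (p ℓ : ℕ) : (EX12 p ℓ).IsTwoTorsionNF := ⟨rfl, rfl, rfl⟩

/-- `Ξ_V[d] ∈ H¹(ℚ, V)` (tree: `twoIsogenyTorsorHom`). -/
abbrev Xi (V : WeierstrassCurve ℚ) [V.IsTwoTorsionNF] [V.IsElliptic] (d : ℚ) : V.galH1 :=
  V.twoIsogenyTorsorHom (Additive.ofMul (sqClass d))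

/-- A primitive point of the conic `3x² = py² + z²` with `x > 0`. -/
def ConicData (p : ℕ) (x y z : ℤ) : Prop :=
  0 < x ∧ 3 * x ^ 2 = p * y ^ 2 + z ^ 2 ∧ Int.gcd x y = 1

section Local

variable (F : Type*) [Field F]

/-- The tangent-line pushout form `L(s,t,r) = z·s² − 3ℓ(z + 2x)·t² + y·r` (g25). -/
def pushL (ℓ : ℕ) (x y z : ℤ) (P : F × F × F) : F :=
  (z : F) * P.1 ^ 2 - 3 * (ℓ : F) * ((z : F) + 2 * (x : F)) * P.2.1 ^ 2 + (y : F) * P.2.2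

/-- Admissible local point of `C_{−p} : r² = −p s⁴ + 6pℓ s²t² + 3pℓ² t⁴` with `L(P) ≠ 0` (g25). -/
def AdmissiblePt (p ℓ : ℕ) (x y z : ℤ) (P : F × F × F) : Prop :=
  P.2.2 ^ 2 = -(p : F) * P.1 ^ 4 + 6 * (p : F) * (ℓ : F) * P.1 ^ 2 * P.2.1 ^ 2 +
      3 * (p : F) * (ℓ : F) ^ 2 * P.2.1 ^ 4 ∧
    pushL F ℓ x y z P ≠ 0

/-- The local Cassels–Tate term `(L(P), η)_F` (g25). -/
def locSym (ℓ : ℕ) (x y z : ℤ) (η : ℚ) (P : F × F × F) : ℤ :=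
  hilbertSymbol F (pushL F ℓ x y z P) (η : F)

/-! ### g26: the general local data -/

/-- The tangent form `Λ_c(P) = c₁ s² + c₂ t² + c₃ r` at an affine point `P = (s, t, r)`. -/
def tangentForm (c₁ c₂ c₃ : ℤ) (P : F × F × F) : F :=
  (c₁ : F) * P.1 ^ 2 + (c₂ : F) * P.2.1 ^ 2 + (c₃ : F) * P.2.2

/-- `P = (s, t, r) ∈ F³` is an affine point of the torsor `C_d : r² = d s⁴ + a s²t² + e t⁴`
(`= Ξ_V[d]`, AEC X.4.9 / Fisher §5 `C₁`) with `Λ_c(P) ≠ 0`. -/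
def TorsorPt (a d e c₁ c₂ c₃ : ℤ) (P : F × F × F) : Prop :=
  P.2.2 ^ 2 = (d : F) * P.1 ^ 4 + (a : F) * P.1 ^ 2 * P.2.1 ^ 2 + (e : F) * P.2.1 ^ 4 ∧
    tangentForm F c₁ c₂ c₃ P ≠ 0

/-- The local term `(Λ_c(P), η)_F ∈ {±1}` (tree Hilbert symbol). -/
def tangentSym (c₁ c₂ c₃ : ℤ) (η : ℚ) (P : F × F × F) : ℤ :=
  hilbertSymbol F (tangentForm F c₁ c₂ c₃ P) (η : F)

end Local

/-- The five-place product `∏_{v ∈ {∞, 2, 3, p, ℓ}} (L(P_v), η)_v` (g25). -/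
def localProduct (p ℓ : ℕ) [Fact p.Prime] [Fact ℓ.Prime] (x y z : ℤ) (η : ℚ)
    (Pinf : ℝ × ℝ × ℝ) (P₂ : ℚ_[2] × ℚ_[2] × ℚ_[2]) (P₃ : ℚ_[3] × ℚ_[3] × ℚ_[3])
    (Pp : ℚ_[p] × ℚ_[p] × ℚ_[p]) (Pl : ℚ_[ℓ] × ℚ_[ℓ] × ℚ_[ℓ]) : ℤ :=
  locSym ℝ ℓ x y z η Pinf * locSym ℚ_[2] ℓ x y z η P₂ * locSym ℚ_[3] ℓ x y z η P₃ *
    locSym ℚ_[p] ℓ x y z η Pp * locSym ℚ_[ℓ] ℓ x y z η Pl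

/-- The value `½ ∈ ℚ/ℤ` (g25). -/
def half : AddCircle (1 : ℚ) := (((1 : ℚ) / 2 : ℚ) : AddCircle (1 : ℚ))

/-- **P1-min** (verbatim g25). -/
def CasselsFormulaX12 : Prop :=
  ∀ (p ℓ : ℕ) [Fact p.Prime] [Fact ℓ.Prime], IsX12Pair p ℓ → ∀ [(EX12 p ℓ).IsElliptic],
    ∃ B : (EX12 p ℓ).sha →+ (EX12 p ℓ).sha →+ AddCircle (1 : ℚ),
      (∀ a, B a a = 0) ∧
      ∀ (x y z : ℤ), ConicData p x y z → ∀ (η : ℚ), η ≠ 0 →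
      ∀ (h₁ : Xi (EX12 p ℓ) (-(p : ℚ)) ∈ (EX12 p ℓ).sha) (h₂ : Xi (EX12 p ℓ) η ∈ (EX12 p ℓ).sha)
        (Pinf : ℝ × ℝ × ℝ) (P₂ : ℚ_[2] × ℚ_[2] × ℚ_[2]) (P₃ : ℚ_[3] × ℚ_[3] × ℚ_[3])
        (Pp : ℚ_[p] × ℚ_[p] × ℚ_[p]) (Pl : ℚ_[ℓ] × ℚ_[ℓ] × ℚ_[ℓ]),
        AdmissiblePt ℝ p ℓ x y z Pinf → AdmissiblePt ℚ_[2] p ℓ x y z P₂ → AdmissiblePt ℚ_[3] p ℓ x y z P₃ →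
        AdmissiblePt ℚ_[p] p ℓ x y z Pp → AdmissiblePt ℚ_[ℓ] p ℓ x y z Pl →
          B ⟨_, h₁⟩ ⟨_, h₂⟩ = if localProduct p ℓ x y z η Pinf P₂ P₃ Pp Pl = -1 then half else 0

/-! ### g26: the general named `Prop` -/

/-- `(c₁ : c₂ : c₃)` lies on the dual conic of `Γ_d : R² = dU² + aUV + eV²`, i.e. the line
`c₁U + c₂V + c₃R = 0` is tangent to `Γ_d` (adjugate of `diag([[d, a/2],[a/2, e]], −1)`, times `−4`). -/
def OnDualConic (a d e c₁ c₂ c₃ : ℤ) : Prop :=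
  4 * e * c₁ ^ 2 - 4 * a * c₁ * c₂ + 4 * d * c₂ ^ 2 + (a ^ 2 - 4 * (d * e)) * c₃ ^ 2 = 0

/-- The exceptional primes of the datum: `q ∣ 2b(a² − 4b)` (bad reduction of `E_{a,b}`, `V`, `C_d`)
or `q ∣ c₁, c₂, c₃` (the form `Λ_c` vanishes mod `q`). -/
def IsExceptionalPrime (a b c₁ c₂ c₃ : ℤ) (q : ℕ) : Prop :=
  q ∣ (2 * b * (a ^ 2 - 4 * b)).natAbs ∨ ((q : ℤ) ∣ c₁ ∧ (q : ℤ) ∣ c₂ ∧ (q : ℤ) ∣ c₃)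

/-- **The general tangent-form Cassels–Tate formula for a rational `2`-isogeny** (Fisher arXiv:1509.03234
§3 display p.6 + Lemma 7.1 p.13 + §5 p.10; Cassels 1998).  For `V/ℚ : y² = x(x² + a_V x + b_V)` with
`V.twoIsogenyCodomain = E_{a,b}`, `b(a²−4b) ≠ 0`, `d e = b`, there is an alternating bi-additive pairing
`B` on `Ш(V/ℚ)` such that for every integer point `c` of the dual conic of `Γ_d`, every `η ∈ ℚ^×` and all
`Ξ_V[d], Ξ_V[η] ∈ Ш(V)`, there are local invariants `σ_∞ ∈ ℤ`, `σ : ℕ → ℤ` with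
(i) `(Λ_c(P), η)_ℝ = σ_∞` for every `P ∈ C_d(ℝ)` with `Λ_c(P) ≠ 0`, and `(Λ_c(P), η)_q = σ q` for every
prime `q` and every `P ∈ C_d(ℚ_q)` with `Λ_c(P) ≠ 0`; (ii) `σ q = 1` for every non-exceptional prime `q`;
(iii) for every finite set `T` of primes containing the exceptional ones,
`B(Ξ[d], Ξ[η]) = ½` if `σ_∞ · ∏_{q ∈ T} σ q = −1`, and `= 0` otherwise. -/
def CasselsTateTwoIsogenyTangentFormula : Prop :=
  ∀ (a b d e : ℤ), b * (a ^ 2 - 4 * b) ≠ 0 → d * e = b →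
  ∀ (V : WeierstrassCurve ℚ) [V.IsTwoTorsionNF] [V.IsElliptic],
    V.twoIsogenyCodomain = ⟨0, (a : ℚ), 0, (b : ℚ), 0⟩ →
    ∃ B : V.sha →+ V.sha →+ AddCircle (1 : ℚ),
      (∀ x, B x x = 0) ∧
      ∀ (c₁ c₂ c₃ : ℤ), OnDualConic a d e c₁ c₂ c₃ → ∀ (η : ℚ), η ≠ 0 →
      ∀ (h₁ : Xi V (d : ℚ) ∈ V.sha) (h₂ : Xi V η ∈ V.sha),
        ∃ (σinf : ℤ) (σ : ℕ → ℤ),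
          (∀ P : ℝ × ℝ × ℝ, TorsorPt ℝ a d e c₁ c₂ c₃ P → tangentSym ℝ c₁ c₂ c₃ η P = σinf) ∧
          (∀ (q : ℕ) [Fact q.Prime] (P : ℚ_[q] × ℚ_[q] × ℚ_[q]),
              TorsorPt ℚ_[q] a d e c₁ c₂ c₃ P → tangentSym ℚ_[q] c₁ c₂ c₃ η P = σ q) ∧
          (∀ q : ℕ, q.Prime → ¬ IsExceptionalPrime a b c₁ c₂ c₃ q → σ q = 1) ∧
          ∀ T : Finset ℕ, (∀ q ∈ T, q.Prime) →
            (∀ q : ℕ, q.Prime → IsExceptionalPrime a b c₁ c₂ c₃ q → q ∈ T) →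
              B ⟨_, h₁⟩ ⟨_, h₂⟩ = if σinf * ∏ q ∈ T, σ q = -1 then half else 0

/-! ### g26: the X12 corner is an instance (kernel-checked) -/

section X12

variable {p ℓ : ℕ} {x y z : ℤ}

/-- `E_X12' = E_{6pℓ, −3p²ℓ²}`. -/
theorem twoIsogenyCodomain_EX12 (p ℓ : ℕ) :
    (EX12 p ℓ).twoIsogenyCodomain =
      ⟨0, ((6 * (p : ℤ) * ℓ : ℤ) : ℚ), 0, ((-3 * (p : ℤ) ^ 2 * (ℓ : ℤ) ^ 2 : ℤ) : ℚ), 0⟩ := by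
  ext <;> simp [EX12, twoIsogenyCodomain] <;> ring

/-- The X12 tangent datum `c = (z, −3ℓ(z+2x), y)` lies on the dual conic of `Γ_{−p}` because
`3x² = py² + z²`. -/
theorem onDualConic_X12 (p ℓ : ℕ) (h : 3 * x ^ 2 = p * y ^ 2 + z ^ 2) :
    OnDualConic (6 * (p : ℤ) * ℓ) (-(p : ℤ)) (3 * (p : ℤ) * (ℓ : ℤ) ^ 2)
      z (-3 * (ℓ : ℤ) * (z + 2 * x)) y := by
  unfold OnDualConic
  linear_combination (-(48 : ℤ) * p * (ℓ : ℤ) ^ 2) * h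

section Forms

variable (F : Type*) [Field F]

theorem tangentForm_X12 (ℓ : ℕ) (x y z : ℤ) (P : F × F × F) :
    tangentForm F z (-3 * (ℓ : ℤ) * (z + 2 * x)) y P = pushL F ℓ x y z P := by
  simp only [tangentForm, pushL]
  push_cast
  ring

theorem torsorPt_X12_iff (p ℓ : ℕ) (x y z : ℤ) (P : F × F × F) :
    TorsorPt F (6 * (p : ℤ) * ℓ) (-(p : ℤ)) (3 * (p : ℤ) * (ℓ : ℤ) ^ 2)
        z (-3 * (ℓ : ℤ) * (z + 2 * x)) y P ↔ AdmissiblePt F p ℓ x y z P := by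
  simp only [TorsorPt, AdmissiblePt, tangentForm_X12]
  push_cast
  constructor
  · rintro ⟨h1, h2⟩; exact ⟨by linear_combination h1, h2⟩
  · rintro ⟨h1, h2⟩; exact ⟨by linear_combination h1, h2⟩

theorem tangentSym_X12 (ℓ : ℕ) (x y z : ℤ) (η : ℚ) (P : F × F × F) :
    tangentSym F z (-3 * (ℓ : ℤ) * (z + 2 * x)) y η P = locSym F ℓ x y z η P := by
  simp only [tangentSym, locSym, tangentForm_X12]

end Forms

/-- For an X12 pair: `p, ℓ` are primes `≠ 2, 3` and `p ≠ ℓ`. -/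
theorem X12_primes (h : IsX12Pair p ℓ) :
    p.Prime ∧ ℓ.Prime ∧ p ≠ 2 ∧ p ≠ 3 ∧ ℓ ≠ 2 ∧ ℓ ≠ 3 ∧ p ≠ ℓ := by
  obtain ⟨hp, hl, hp12, hl24, hj⟩ := h
  refine ⟨hp, hl, by omega, by omega, by omega, by omega, ?_⟩
  rintro rfl
  have h0 : jacobiSym (p : ℤ) p = 0 :=
    jacobiSym.eq_zero_iff.mpr ⟨hp.ne_zero, by rw [Int.gcd_natCast_natCast, Nat.gcd_self]; exact hp.one_lt.ne'⟩
  rw [h0] at hj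
  norm_num at hj

/-- The exceptional primes of the X12 datum lie in `{2, 3, p, ℓ}`. -/
theorem exceptional_X12 (h : IsX12Pair p ℓ) (hC : ConicData p x y z) (q : ℕ) (hq : q.Prime)
    (hE : IsExceptionalPrime (6 * (p : ℤ) * ℓ) (-3 * (p : ℤ) ^ 2 * (ℓ : ℤ) ^ 2)
      z (-3 * (ℓ : ℤ) * (z + 2 * x)) y q) :
    q ∈ ({2, 3, p, ℓ} : Finset ℕ) := by
  obtain ⟨hp, hl, -, -, -, -, -⟩ := X12_primes h
  simp only [Finset.mem_insert, Finset.mem_singleton]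
  rcases hE with hN | ⟨hz, -, hy⟩
  · -- `2b(a²−4b) = −288 p⁴ ℓ⁴`
    have hN' : (2 * (-3 * (p : ℤ) ^ 2 * (ℓ : ℤ) ^ 2) *
        ((6 * (p : ℤ) * ℓ) ^ 2 - 4 * (-3 * (p : ℤ) ^ 2 * (ℓ : ℤ) ^ 2))).natAbs =
          288 * (p ^ 4 * ℓ ^ 4) := by
      have : (2 * (-3 * (p : ℤ) ^ 2 * (ℓ : ℤ) ^ 2) *
          ((6 * (p : ℤ) * ℓ) ^ 2 - 4 * (-3 * (p : ℤ) ^ 2 * (ℓ : ℤ) ^ 2))) =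
            -(((288 * (p ^ 4 * ℓ ^ 4) : ℕ) : ℤ)) := by push_cast; ring
      rw [this, Int.natAbs_neg, Int.natAbs_natCast]
    rw [hN'] at hN
    rcases (Nat.Prime.dvd_mul hq).mp hN with h288 | hpl
    · -- `288 = 2⁵ · 3²`
      have h288' : q ∣ 2 ^ 5 * 3 ^ 2 := by norm_num; exact h288
      rcases (Nat.Prime.dvd_mul hq).mp h288' with h2 | h3
      · exact Or.inl ((Nat.prime_dvd_prime_iff_eq hq Nat.prime_two).mp (hq.dvd_of_dvd_pow h2))
      · exact Or.inr (Or.inl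
          ((Nat.prime_dvd_prime_iff_eq hq Nat.prime_three).mp (hq.dvd_of_dvd_pow h3)))
    · rcases (Nat.Prime.dvd_mul hq).mp hpl with h4 | h4
      · exact Or.inr (Or.inr (Or.inl
          ((Nat.prime_dvd_prime_iff_eq hq hp).mp (hq.dvd_of_dvd_pow h4))))
      · exact Or.inr (Or.inr (Or.inr
          ((Nat.prime_dvd_prime_iff_eq hq hl).mp (hq.dvd_of_dvd_pow h4))))
  · -- a prime dividing `z` and `y` divides `3x²`; it is `3` since `gcd(x, y) = 1`
    obtain ⟨hx0, hxyz, hg⟩ := hC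
    have hq' : Prime (q : ℤ) := Nat.prime_iff_prime_int.mp hq
    have h3x : (q : ℤ) ∣ 3 * x ^ 2 := by
      rw [hxyz]; exact dvd_add (dvd_mul_of_dvd_right (dvd_pow hy two_ne_zero) _) (dvd_pow hz two_ne_zero)
    rcases hq'.dvd_or_dvd h3x with h3 | hx2
    · have : q ∣ 3 := by exact_mod_cast Int.natCast_dvd.mp h3
      exact Or.inr (Or.inl ((Nat.prime_dvd_prime_iff_eq hq Nat.prime_three).mp this))
    · have hx : (q : ℤ) ∣ x := hq'.dvd_of_dvd_pow hx2
      have h1 : q ∣ Int.gcd x y := Int.dvd_gcd hx hy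
      rw [hg] at h1
      exact absurd (Nat.dvd_one.mp h1) hq.one_lt.ne'

/-- **Kernel-checked specialisation.** The general tangent-form Cassels–Tate formula gives
`CasselsFormulaX12` (the X12 corner's P1-min), with `(a,b,d,e) = (6pℓ, −3p²ℓ², −p, 3pℓ²)`,
`c = (z, −3ℓ(z+2x), y)`, `T = {2, 3, p, ℓ}`. -/
theorem casselsFormulaX12_of_tangentFormula (hG : CasselsTateTwoIsogenyTangentFormula) :
    CasselsFormulaX12 := by
  intro p ℓ _ _ hX _
  obtain ⟨hp, hl, hp2, hp3, hl2, hl3, hpl⟩ := X12_primes hX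
  -- the instance data
  have hab : (-3 * (p : ℤ) ^ 2 * (ℓ : ℤ) ^ 2) *
      ((6 * (p : ℤ) * ℓ) ^ 2 - 4 * (-3 * (p : ℤ) ^ 2 * (ℓ : ℤ) ^ 2)) ≠ 0 := by
    have hp0 : (p : ℤ) ≠ 0 := by exact_mod_cast hp.ne_zero
    have hl0 : (ℓ : ℤ) ≠ 0 := by exact_mod_cast hl.ne_zero
    have : (-3 * (p : ℤ) ^ 2 * (ℓ : ℤ) ^ 2) *
        ((6 * (p : ℤ) * ℓ) ^ 2 - 4 * (-3 * (p : ℤ) ^ 2 * (ℓ : ℤ) ^ 2)) =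
          -144 * ((p : ℤ) * ℓ) ^ 4 := by ring
    rw [this]
    exact mul_ne_zero (by norm_num) (pow_ne_zero _ (mul_ne_zero hp0 hl0))
  have hde : (-(p : ℤ)) * (3 * (p : ℤ) * (ℓ : ℤ) ^ 2) = -3 * (p : ℤ) ^ 2 * (ℓ : ℤ) ^ 2 := by ring
  obtain ⟨B, hBalt, hB⟩ := hG _ _ _ _ hab hde (EX12 p ℓ) (twoIsogenyCodomain_EX12 p ℓ)
  refine ⟨B, hBalt, ?_⟩
  intro x y z hC η hη h₁ h₂ Pinf P₂ P₃ Pp Pl hAinf hA2 hA3 hAp hAl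
  have hB' := hB z (-3 * (ℓ : ℤ) * (z + 2 * x)) y (onDualConic_X12 p ℓ hC.2.1) η hη
  simp only [Int.cast_neg, Int.cast_natCast] at hB'
  obtain ⟨σinf, σ, hσinf, hσ, -, hT⟩ := hB' h₁ h₂
  -- the five local terms are the invariants
  have einf : locSym ℝ ℓ x y z η Pinf = σinf := by
    rw [← tangentSym_X12]; exact hσinf Pinf ((torsorPt_X12_iff ℝ p ℓ x y z Pinf).mpr hAinf)
  have e2 : locSym ℚ_[2] ℓ x y z η P₂ = σ 2 := by
    rw [← tangentSym_X12]; exact hσ 2 P₂ ((torsorPt_X12_iff ℚ_[2] p ℓ x y z P₂).mpr hA2)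
  have e3 : locSym ℚ_[3] ℓ x y z η P₃ = σ 3 := by
    rw [← tangentSym_X12]; exact hσ 3 P₃ ((torsorPt_X12_iff ℚ_[3] p ℓ x y z P₃).mpr hA3)
  have ep : locSym ℚ_[p] ℓ x y z η Pp = σ p := by
    rw [← tangentSym_X12]; exact hσ p Pp ((torsorPt_X12_iff ℚ_[p] p ℓ x y z Pp).mpr hAp)
  have el : locSym ℚ_[ℓ] ℓ x y z η Pl = σ ℓ := by
    rw [← tangentSym_X12]; exact hσ ℓ Pl ((torsorPt_X12_iff ℚ_[ℓ] p ℓ x y z Pl).mpr hAl)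
  -- the formula over `T = {2, 3, p, ℓ}`
  have hTprime : ∀ q ∈ ({2, 3, p, ℓ} : Finset ℕ), q.Prime := by
    intro q hq
    simp only [Finset.mem_insert, Finset.mem_singleton] at hq
    rcases hq with rfl | rfl | rfl | rfl
    · exact Nat.prime_two
    · exact Nat.prime_three
    · exact hp
    · exact hl
  have key := hT {2, 3, p, ℓ} hTprime (fun q hq hE => exceptional_X12 hX hC q hq hE)
  have hprod : ∏ q ∈ ({2, 3, p, ℓ} : Finset ℕ), σ q = σ 2 * (σ 3 * (σ p * σ ℓ)) := by
    rw [Finset.prod_insert (by simp; omega), Finset.prod_insert (by simp; omega),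
      Finset.prod_insert (by simpa using hpl), Finset.prod_singleton]
  have hloc : localProduct p ℓ x y z η Pinf P₂ P₃ Pp Pl = σinf * ∏ q ∈ ({2, 3, p, ℓ} : Finset ℕ), σ q := by
    rw [hprod, localProduct, einf, e2, e3, ep, el]; ring
  rw [hloc]
  exact key

end X12

/-! ### g27: the HOISTED forms (critic V#24c) and their kernel-checked glue -/

/-- **The 2-isogeny tangent-form Cassels–Tate formula, ONE pairing for all data** (hoist prescribed by
critic V#24c).  For `V/ℚ : y² = x(x² + a_V x + b_V)` (two-torsion normal form, elliptic) there is an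
alternating bi-additive pairing `B` on `Ш(V/ℚ)` (the Cassels–Tate pairing) such that for ALL integers
`a b d e` with `b(a²−4b) ≠ 0`, `d e = b` and `V.twoIsogenyCodomain = E_{a,b}`, every integer point `c` of the
dual conic of `Γ_d : R² = dU² + aUV + eV²`, every `η ∈ ℚ^×` and all `Ξ_V[d], Ξ_V[η] ∈ Ш(V)`, there are local
invariants `σ_∞ ∈ ℤ`, `σ : ℕ → ℤ` with
(i) `(Λ_c(P), η)_ℝ = σ_∞` for every `P ∈ C_d(ℝ)` with `Λ_c(P) ≠ 0`; (i′) `(Λ_c(P), η)_q = σ q` for every prime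
`q` and every `P ∈ C_d(ℚ_q)` with `Λ_c(P) ≠ 0`; (ii) `σ q = 1` for every non-exceptional prime `q`;
(iii) for every finite set `T` of primes containing the exceptional ones,
`B(Ξ[d], Ξ[η]) = ½` if `σ_∞ · ∏_{q ∈ T} σ q = −1`, and `= 0` otherwise.
Sources: Fisher arXiv:1509.03234 (= Math. Comp. 86 (2017)) §3 display + Thm 3.1(i) p.6, §5 (`C₁`) p.10,
§7 + Lemma 7.1 p.13; Cassels, Crelle 494 (1998) 101–127 §7 (not held); Wang arXiv:1511.03810 pp.4–5 (Lemma 2 =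
Cassels' Lemma 7.2, clause (ii)).  Clauses (i)–(iii) are byte-identical to g26's. -/
def CasselsTateTwoIsogenyPairingFormula : Prop :=
  ∀ (V : WeierstrassCurve ℚ) [V.IsTwoTorsionNF] [V.IsElliptic],
    ∃ B : V.sha →+ V.sha →+ AddCircle (1 : ℚ),
      (∀ x, B x x = 0) ∧
      ∀ (a b d e : ℤ), b * (a ^ 2 - 4 * b) ≠ 0 → d * e = b →
        V.twoIsogenyCodomain = ⟨0, (a : ℚ), 0, (b : ℚ), 0⟩ →
        ∀ (c₁ c₂ c₃ : ℤ), OnDualConic a d e c₁ c₂ c₃ → ∀ (η : ℚ), η ≠ 0 →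
        ∀ (h₁ : Xi V (d : ℚ) ∈ V.sha) (h₂ : Xi V η ∈ V.sha),
          ∃ (σinf : ℤ) (σ : ℕ → ℤ),
            (∀ P : ℝ × ℝ × ℝ, TorsorPt ℝ a d e c₁ c₂ c₃ P → tangentSym ℝ c₁ c₂ c₃ η P = σinf) ∧
            (∀ (q : ℕ) [Fact q.Prime] (P : ℚ_[q] × ℚ_[q] × ℚ_[q]),
                TorsorPt ℚ_[q] a d e c₁ c₂ c₃ P → tangentSym ℚ_[q] c₁ c₂ c₃ η P = σ q) ∧
            (∀ q : ℕ, q.Prime → ¬ IsExceptionalPrime a b c₁ c₂ c₃ q → σ q = 1) ∧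
            ∀ T : Finset ℕ, (∀ q ∈ T, q.Prime) →
              (∀ q : ℕ, q.Prime → IsExceptionalPrime a b c₁ c₂ c₃ q → q ∈ T) →
                B ⟨_, h₁⟩ ⟨_, h₂⟩ = if σinf * ∏ q ∈ T, σ q = -1 then half else 0

/-- **The same, with `B` a Cassels–Tate pairing in the tree's sense**: alternating AND
`ker B = divisible elements of Ш(V)` (the two clauses of `WeierstrassCurve.exists_casselsTate_pairing`,
AEC X.4.14 / Cassels 1962 / Tate 1962), AND Cassels' 2-isogeny formula (clauses as above). -/
def CasselsTateTwoIsogenyPairingFormulaCT : Prop :=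
  ∀ (V : WeierstrassCurve ℚ) [V.IsTwoTorsionNF] [V.IsElliptic],
    ∃ B : V.sha →+ V.sha →+ AddCircle (1 : ℚ),
      (∀ x, B x x = 0) ∧
      (∀ x, (∀ y, B x y = 0) ↔ x ∈ AddSubgroup.divisibleElements V.sha) ∧
      ∀ (a b d e : ℤ), b * (a ^ 2 - 4 * b) ≠ 0 → d * e = b →
        V.twoIsogenyCodomain = ⟨0, (a : ℚ), 0, (b : ℚ), 0⟩ →
        ∀ (c₁ c₂ c₃ : ℤ), OnDualConic a d e c₁ c₂ c₃ → ∀ (η : ℚ), η ≠ 0 →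
        ∀ (h₁ : Xi V (d : ℚ) ∈ V.sha) (h₂ : Xi V η ∈ V.sha),
          ∃ (σinf : ℤ) (σ : ℕ → ℤ),
            (∀ P : ℝ × ℝ × ℝ, TorsorPt ℝ a d e c₁ c₂ c₃ P → tangentSym ℝ c₁ c₂ c₃ η P = σinf) ∧
            (∀ (q : ℕ) [Fact q.Prime] (P : ℚ_[q] × ℚ_[q] × ℚ_[q]),
                TorsorPt ℚ_[q] a d e c₁ c₂ c₃ P → tangentSym ℚ_[q] c₁ c₂ c₃ η P = σ q) ∧
            (∀ q : ℕ, q.Prime → ¬ IsExceptionalPrime a b c₁ c₂ c₃ q → σ q = 1) ∧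
            ∀ T : Finset ℕ, (∀ q ∈ T, q.Prime) →
              (∀ q : ℕ, q.Prime → IsExceptionalPrime a b c₁ c₂ c₃ q → q ∈ T) →
                B ⟨_, h₁⟩ ⟨_, h₂⟩ = if σinf * ∏ q ∈ T, σ q = -1 then half else 0

/-- Drop the kernel clause. -/
theorem pairingFormula_of_CT (h : CasselsTateTwoIsogenyPairingFormulaCT) :
    CasselsTateTwoIsogenyPairingFormula := by
  intro V _ _
  obtain ⟨B, hBalt, -, hB⟩ := h V
  exact ⟨B, hBalt, hB⟩

/-- The CT variant restricts to the body of the tree's `exists_casselsTate_pairing (K := ℚ)` on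
two-torsion-normal-form curves (currency check). -/
theorem casselsTate_clause_of_CT (h : CasselsTateTwoIsogenyPairingFormulaCT) :
    ∀ (V : WeierstrassCurve ℚ) [V.IsTwoTorsionNF] [V.IsElliptic],
      ∃ B : V.sha →+ V.sha →+ AddCircle (1 : ℚ),
        (∀ x, B x x = 0) ∧ ∀ x, (∀ y, B x y = 0) ↔ x ∈ AddSubgroup.divisibleElements V.sha := by
  intro V _ _
  obtain ⟨B, hBalt, hBker, -⟩ := h V
  exact ⟨B, hBalt, hBker⟩

/-- Conversely, the tree's global fact gives the CT clauses on every such curve (so the CT variant asks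
of the typer exactly `exists_casselsTate_pairing`'s content plus the formula, for ONE `B`). -/
theorem casselsTate_clause_of_tree (h : exists_casselsTate_pairing (K := ℚ))
    (V : WeierstrassCurve ℚ) [V.IsElliptic] :
    ∃ B : V.sha →+ V.sha →+ AddCircle (1 : ℚ),
      (∀ x, B x x = 0) ∧ ∀ x, (∀ y, B x y = 0) ↔ x ∈ AddSubgroup.divisibleElements V.sha :=
  h V

/-- **Hoisted ⇒ un-hoisted**: the one pairing serves every `(a, b, d, e)`. -/
theorem tangentFormula_of_pairingFormula (h : CasselsTateTwoIsogenyPairingFormula) :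
    CasselsTateTwoIsogenyTangentFormula := by
  intro a b d e hab hde V _ _ hV
  obtain ⟨B, hBalt, hB⟩ := h V
  exact ⟨B, hBalt, fun c₁ c₂ c₃ hc η hη h₁ h₂ => hB a b d e hab hde hV c₁ c₂ c₃ hc η hη h₁ h₂⟩

/-- The X12 corner's P1-min from the hoisted input. -/
theorem casselsFormulaX12_of_pairingFormula (h : CasselsTateTwoIsogenyPairingFormula) :
    CasselsFormulaX12 :=
  casselsFormulaX12_of_tangentFormula (tangentFormula_of_pairingFormula h)

/-- The X12 corner's P1-min from the CT variant. -/
theorem casselsFormulaX12_of_CT (h : CasselsTateTwoIsogenyPairingFormulaCT) : CasselsFormulaX12 :=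
  casselsFormulaX12_of_pairingFormula (pairingFormula_of_CT h)

end Summit.BirchSwinnertonDyer.BirchSwinnertonDyer.Cruxes.HeegnerTwistCouplingInSupply.TransferG27

end
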